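import Literature.NumberTheory.LFunctions.YoshidaWindowGramMiddleJBox
import HarnessLib

/-!
# Format C kit: single-pass ("sequential walk") form of the column sums over the light table

`Encl.sumBox S f K` with `f t = h (tget ctab (B + t + 1)) (v_t) t` re-walks the light table `ctab` (a `List IdxRec` produced by
`tabOfPacked`, i.e. a lazily decoded cons list) from its head for every column `t`; under `decide +kernel` the walk dominates the cost and the
kernel's whnf cache keeps every intermediate `List.getD` term, which trips the kernel memory guard on the 704-column odd middle moments of the
`a = 1` rung (`hmAAoBox … 320 704`, rh-explicit-weil-2 gen11, 2026-08-23).  `seqSumBox` computes the same left-nested sum while walking the record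
list and the weight list ONCE; `sumBox_eq_seqSumBox` is the (definitional-up-to-induction) equality, and `hmAAoBox_eq_seq` / `hmABoBox_eq_seq` /
`hmBAoBox_eq_seq` (odd, columns `B₃+t+1`) and `hmAAeBox_eq_seq` / `hmABeBox_eq_seq` / `hmBAeBox_eq_seq` (even, columns `B₃+t`)
are the instances used by the rung files (`rw` before `decide +kernel`).  Pure list bookkeeping; no analysis. [folklore]
-/

set_option linter.dupNamespace false

namespace Summit.RiemannHypothesis.RiemannHypothesis.Theorems.WeilFormatCData
open Literature.NumberTheory.LFunctions Literature.NumberTheory.LFunctions.Yoshida1992 Encl Literature.Analysis.ValidatedNumerics.NumericsMP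

/-- Left-nested interval sum `acc + Σ_{s<n} h l[s] w[s] (t+s)` computed in ONE pass over the record list `l` and the weight list `w`
(missing entries read as `default` / `0`, exactly like `tget` / `List.getD`). [folklore] -/
def seqSumBox (S : ℕ) (h : IdxRec → ℕ → ℕ → MI) : MI → List IdxRec → List ℕ → ℕ → ℕ → MI
  | acc, _, _, _, 0 => acc
  | acc, l, w, t, n + 1 => seqSumBox S h (acc.add (h (l.headD default) (w.headD 0) t)) l.tail w.tail (t + 1) n

/-- [folklore] -/
theorem tail_getD {α : Type*} (l : List α) (n : ℕ) (d : α) : l.tail.getD n d = l.getD (n + 1) d := by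
  cases l <;> simp

/-- Peeling the LAST summand off the single-pass sum. [folklore] -/
theorem seqSumBox_succ (S : ℕ) (h : IdxRec → ℕ → ℕ → MI) :
    ∀ (n : ℕ) (acc : MI) (l : List IdxRec) (w : List ℕ) (t : ℕ),
      seqSumBox S h acc l w t (n + 1) = (seqSumBox S h acc l w t n).add (h (l.getD n default) (w.getD n 0) (t + n))
  | 0, acc, l, w, t => by
    cases l <;> cases w <;> rfl
  | n + 1, acc, l, w, t => by
    rw [seqSumBox, seqSumBox_succ S h n, ← tail_getD l n, ← tail_getD w n, show t + (n + 1) = t + 1 + n by omega]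
    rfl

/-- `sumBox` over columns read by `tget L (B + t + 1)` and weights `W.getD t 0` equals the single-pass sum over `L.drop (B + 1)` and `W`.
[folklore] -/
theorem sumBox_eq_seqSumBox (S : ℕ) (h : IdxRec → ℕ → ℕ → MI) (L : List IdxRec) (W : List ℕ) (B : ℕ) :
    ∀ K, sumBox S (fun t ↦ h (tget L (B + t + 1)) (W.getD t 0) t) K = seqSumBox S h (MI.ofInt S 0) (L.drop (B + 1)) W 0 K
  | 0 => rfl
  | K + 1 => by
    rw [sumBox, seqSumBox_succ, sumBox_eq_seqSumBox S h L W B K, Nat.zero_add]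
    congr 2
    simp only [tget, List.getD_eq_getElem?_getD, List.getElem?_drop, show B + 1 + K = B + K + 1 by omega]

/-- Single-pass form of `hmAAoBox`. [folklore] -/
theorem hmAAoBox_eq_seq (S : ℕ) (C : Consts) (ctab : List IdxRec) (cv : ℕ) (v : List ℕ) (B₃ K j j' : ℕ) :
    hmAAoBox S C ctab cv v B₃ K j j' = seqSumBox S
      (fun r wt t ↦ (((fAoBox S C r (B₃ + t) j).mul S (fAoBox S C r (B₃ + t) j')).mulInt (wt : ℤ)).divNat (2 ^ cv))
      (MI.ofInt S 0) (ctab.drop (B₃ + 1)) v 0 K := by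
  unfold hmAAoBox
  exact sumBox_eq_seqSumBox S
    (fun r wt t ↦ (((fAoBox S C r (B₃ + t) j).mul S (fAoBox S C r (B₃ + t) j')).mulInt (wt : ℤ)).divNat (2 ^ cv)) ctab v B₃ K

/-- Single-pass form of `hmABoBox`. [folklore] -/
theorem hmABoBox_eq_seq (S : ℕ) (C : Consts) (ctab : List IdxRec) (cv : ℕ) (v : List ℕ) (B₃ K j r' : ℕ) :
    hmABoBox S C ctab cv v B₃ K j r' = seqSumBox S
      (fun r wt t ↦ (((fAoBox S C r (B₃ + t) j).mul S (MI.ofFrac S 1 ((B₃ + t + 1) ^ (2 * r' + 1)))).mulInt (wt : ℤ)).divNat (2 ^ cv))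
      (MI.ofInt S 0) (ctab.drop (B₃ + 1)) v 0 K := by
  unfold hmABoBox
  exact sumBox_eq_seqSumBox S
    (fun r wt t ↦ (((fAoBox S C r (B₃ + t) j).mul S (MI.ofFrac S 1 ((B₃ + t + 1) ^ (2 * r' + 1)))).mulInt (wt : ℤ)).divNat (2 ^ cv)) ctab v B₃ K

/-- Single-pass form of `hmBAoBox`. [folklore] -/
theorem hmBAoBox_eq_seq (S : ℕ) (C : Consts) (ctab : List IdxRec) (cv : ℕ) (v : List ℕ) (B₃ K r' j : ℕ) :
    hmBAoBox S C ctab cv v B₃ K r' j = seqSumBox S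
      (fun r wt t ↦ (((MI.ofFrac S 1 ((B₃ + t + 1) ^ (2 * r' + 1))).mul S (fAoBox S C r (B₃ + t) j)).mulInt (wt : ℤ)).divNat (2 ^ cv))
      (MI.ofInt S 0) (ctab.drop (B₃ + 1)) v 0 K := by
  unfold hmBAoBox
  exact sumBox_eq_seqSumBox S
    (fun r wt t ↦ (((MI.ofFrac S 1 ((B₃ + t + 1) ^ (2 * r' + 1))).mul S (fAoBox S C r (B₃ + t) j)).mulInt (wt : ℤ)).divNat (2 ^ cv)) ctab v B₃ K

/-- `sumBox` over columns read by `tget L (B + t)` (even-sector indexing) equals the single-pass sum over `L.drop B`. [folklore] -/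
theorem sumBox_eq_seqSumBox₀ (S : ℕ) (h : IdxRec → ℕ → ℕ → MI) (L : List IdxRec) (W : List ℕ) (B : ℕ) :
    ∀ K, sumBox S (fun t ↦ h (tget L (B + t)) (W.getD t 0) t) K = seqSumBox S h (MI.ofInt S 0) (L.drop B) W 0 K
  | 0 => rfl
  | K + 1 => by
    rw [sumBox, seqSumBox_succ, sumBox_eq_seqSumBox₀ S h L W B K, Nat.zero_add]
    congr 2
    simp only [tget, List.getD_eq_getElem?_getD, List.getElem?_drop]

/-- Single-pass form of `hmAAeBox`. [folklore] -/
theorem hmAAeBox_eq_seq (S : ℕ) (C : Consts) (ctab : List IdxRec) (cv : ℕ) (v : List ℕ) (B₃ K j j' : ℕ) :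
    hmAAeBox S C ctab cv v B₃ K j j' = seqSumBox S
      (fun r wt t ↦ (((fAeBox S C r (B₃ + t) j).mul S (fAeBox S C r (B₃ + t) j')).mulInt (wt : ℤ)).divNat (2 ^ cv))
      (MI.ofInt S 0) (ctab.drop B₃) v 0 K := by
  unfold hmAAeBox
  exact sumBox_eq_seqSumBox₀ S
    (fun r wt t ↦ (((fAeBox S C r (B₃ + t) j).mul S (fAeBox S C r (B₃ + t) j')).mulInt (wt : ℤ)).divNat (2 ^ cv)) ctab v B₃ K

/-- Single-pass form of `hmABeBox`. [folklore] -/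
theorem hmABeBox_eq_seq (S : ℕ) (C : Consts) (ctab : List IdxRec) (cv : ℕ) (v : List ℕ) (B₃ K j r' : ℕ) :
    hmABeBox S C ctab cv v B₃ K j r' = seqSumBox S
      (fun r wt t ↦ (((fAeBox S C r (B₃ + t) j).mul S (MI.ofFrac S 1 ((B₃ + t) ^ (2 * r' + 2)))).mulInt (wt : ℤ)).divNat (2 ^ cv))
      (MI.ofInt S 0) (ctab.drop B₃) v 0 K := by
  unfold hmABeBox
  exact sumBox_eq_seqSumBox₀ S
    (fun r wt t ↦ (((fAeBox S C r (B₃ + t) j).mul S (MI.ofFrac S 1 ((B₃ + t) ^ (2 * r' + 2)))).mulInt (wt : ℤ)).divNat (2 ^ cv)) ctab v B₃ K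

/-- Single-pass form of `hmBAeBox`. [folklore] -/
theorem hmBAeBox_eq_seq (S : ℕ) (C : Consts) (ctab : List IdxRec) (cv : ℕ) (v : List ℕ) (B₃ K r' j : ℕ) :
    hmBAeBox S C ctab cv v B₃ K r' j = seqSumBox S
      (fun r wt t ↦ (((MI.ofFrac S 1 ((B₃ + t) ^ (2 * r' + 2))).mul S (fAeBox S C r (B₃ + t) j)).mulInt (wt : ℤ)).divNat (2 ^ cv))
      (MI.ofInt S 0) (ctab.drop B₃) v 0 K := by
  unfold hmBAeBox
  exact sumBox_eq_seqSumBox₀ S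
    (fun r wt t ↦ (((MI.ofFrac S 1 ((B₃ + t) ^ (2 * r' + 2))).mul S (fAeBox S C r (B₃ + t) j)).mulInt (wt : ℤ)).divNat (2 ^ cv)) ctab v B₃ K

end Summit.RiemannHypothesis.RiemannHypothesis.Theorems.WeilFormatCData
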